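import Mathlib
import HarnessLib
import Summits.Ventures.LatticeQCDFlow.Exactness.SphereActionThirdMoment

/-!
# Scalar couplings (the O(N) / classical Heisenberg case): the third cumulant of the action is `−(8κ³/d²)·tr(J³)` and Lüscher's NNLO constant is `ċ₂ = (4κ³/d²)·tr(J³)` for a symmetric coupling matrix `J` with zero diagonal

HONEST FRAMING: exact (Metropolis-corrected) sampling algorithms for lattice gauge theory;
figures of merit are autocorrelation/cost numbers at stated couplings and volumes; no
continuum-physics claim.

Venture `LatticeQCDFlow` (cell pub-lqcd), topic `Exactness`; FANOUT row 7 (`s0-cpn-null`).  NEW WORK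
of the cell over the tree's `Exactness/SphereActionThirdMoment.lean` (this leg:
`∫(S − S₀)³ dπ̄ = −(8κ³/d³)·Σ_{k,n,m} Σ_i ⟪U_kn U_nm b_i, U_km b_i⟫` and
`ċ₂ = (4κ³/d³)·Σ_{k,n,m} Σ_i ⟪U_kn U_nm b_i, U_km b_i⟫` for every `C²` Lüscher series of the E–S
action with transporters `U`); nothing is cited as a fact.  Printed counterpart, NAMED ONLY:
M. Lüscher, Commun. Math. Phys. 293 (2010) 899, §4.2; Engel–Schaefer, Comput. Phys. Commun. 182
(2011) 2107, §2 (for the O(N) model the transporters are real numbers `J_nm`).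

THIS FILE evaluates the triangle trace for SCALAR couplings `U_nm = J_nm · 1` (`J` symmetric, zero
diagonal — the O(N)/classical Heisenberg action `S = −κ Σ_{n,m} J_nm ⟪x_n, x_m⟫ + S₀` on an
arbitrary finite weighted graph): `Σ_i ⟪U_kn U_nm b_i, U_km b_i⟫ = d·J_kn J_nm J_km`, the triple sum
is `d·tr(J³)`, and therefore

* **`third_moment_esAction_scalar`** — `∫(S − S₀)³ dπ̄ = −(8κ³/d²)·tr(J³)`;
* **`luscher_constant_two_eq_trace_cube`** — `ċ₂ = (4κ³/d²)·tr(J³)` for every `C²` Lüscher series;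
  `tr(J³) = Σ_{k,n,m} J_kn J_nm J_mk` counts the closed 3-walks of the weighted coupling graph
  (`6·Σ_{triangles} J_e J_e' J_e''`; e.g. `6·(#triangles)` for unit nearest-neighbour couplings
  — `2L²` triangles on the periodic `L × L` triangular lattice — not instantiated here).

NOT CLAIMED: complex / U(1)-phase transporters (`τ = d·cos(flux)`, the CP(N−1) case with frozen
gauge links — not typed here); any particular graph; the rung's numbers.
-/

noncomputable section

namespace Summit.Ventures.LatticeQCDFlow.Exactness

open Function Set Metric MeasureTheory NormedSpace InnerProductSpace
open scoped RealInnerProductSpace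

variable {Λ : Type*} {E : Type*} [NormedAddCommGroup E] [InnerProductSpace ℝ E]
  [FiniteDimensional ℝ E] [MeasurableSpace E] [BorelSpace E] [Fintype Λ] [DecidableEq Λ] [Nontrivial E]

/-! ## §1 The triangle trace of scalar couplings -/

section Scalar

variable (J : Λ → Λ → ℝ)

omit [MeasurableSpace E] [BorelSpace E] [Fintype Λ] [DecidableEq Λ] [Nontrivial E] in
/-- For scalar couplings `U_nm = J_nm · 1` the triangle trace is `d·J_kn J_nm J_km`
(`Σ_i ‖b_i‖² = d` for an orthonormal basis). -/
theorem sum_inner_scalar_couplings (k n m : Λ) :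
    ∑ i, ⟪(J k n • ContinuousLinearMap.id ℝ E) ((J n m • ContinuousLinearMap.id ℝ E)
        (stdOrthonormalBasis ℝ E i)), (J k m • ContinuousLinearMap.id ℝ E) (stdOrthonormalBasis ℝ E i)⟫ =
      (Module.finrank ℝ E : ℝ) * (J k n * J n m * J k m) := by
  simp only [FunLike.coe_smul, Pi.smul_apply, ContinuousLinearMap.id_apply, smul_smul,
    real_inner_smul_left, real_inner_smul_right, real_inner_self_eq_norm_sq,
    (stdOrthonormalBasis ℝ E).orthonormal.1, one_pow, mul_one, Finset.sum_const, Finset.card_univ,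
    nsmul_eq_mul, ← Module.finrank_eq_card_basis (stdOrthonormalBasis ℝ E).toBasis]
  ring

omit [MeasurableSpace E] [BorelSpace E] [Nontrivial E] in
/-- Summed over all triples: `Σ_{k,n,m} τ(k,n,m) = d·tr(J³)` for SYMMETRIC scalar couplings
(`tr(J³) = Σ_k Σ_n Σ_m J_kn J_nm J_mk`, `J` read as a matrix). -/
theorem sum_triangle_trace_scalar (hJs : ∀ n m, J n m = J m n) :
    ∑ k, ∑ n, ∑ m, ∑ i, ⟪(J k n • ContinuousLinearMap.id ℝ E) ((J n m • ContinuousLinearMap.id ℝ E)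
        (stdOrthonormalBasis ℝ E i)), (J k m • ContinuousLinearMap.id ℝ E) (stdOrthonormalBasis ℝ E i)⟫ =
      (Module.finrank ℝ E : ℝ) * (Matrix.of (fun k n => J k n) ^ 3).trace := by
  simp_rw [sum_inner_scalar_couplings]
  rw [pow_succ, pow_two, Matrix.trace]
  simp only [Matrix.diag, Matrix.mul_apply, Matrix.of_apply, Finset.mul_sum, Finset.sum_mul]
  refine Finset.sum_congr rfl fun k _ => ?_
  rw [Finset.sum_comm]
  refine Finset.sum_congr rfl fun m _ => Finset.sum_congr rfl fun n _ => ?_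
  rw [hJs k m]

omit [FiniteDimensional ℝ E] [MeasurableSpace E] [BorelSpace E] [Fintype Λ] [DecidableEq Λ]
  [Nontrivial E] in
/-- Scalar couplings with zero diagonal have no self-coupling … -/
theorem scalar_couplings_diag_zero (hJ0 : ∀ n, J n n = 0) (n : Λ) :
    (J n n • ContinuousLinearMap.id ℝ E) = 0 := by
  rw [hJ0, zero_smul]

omit [FiniteDimensional ℝ E] [MeasurableSpace E] [BorelSpace E] [Fintype Λ] [DecidableEq Λ]
  [Nontrivial E] in
/-- … and symmetric ones form adjoint pairs. -/
theorem scalar_couplings_adjoint (hJs : ∀ n m, J n m = J m n) (m n : Λ) (v w : E) :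
    ⟪(J m n • ContinuousLinearMap.id ℝ E) v, w⟫ = ⟪v, (J n m • ContinuousLinearMap.id ℝ E) w⟫ := by
  simp only [FunLike.coe_smul, Pi.smul_apply, ContinuousLinearMap.id_apply,
    real_inner_smul_left, real_inner_smul_right, hJs m n]

end Scalar

/-! ## §2 The third cumulant and `ċ₂` for the O(N) action -/

section ON

variable {J : Λ → Λ → ℝ}

/-- **THE THIRD CENTRAL MOMENT OF THE O(N)/HEISENBERG ACTION** `S = −κ Σ_{n,m} J_nm⟪x_n, x_m⟫ + S₀`
under the uniform product measure: `∫(S − S₀)³ dπ̄ = −(8κ³/d²)·tr(J³)` (`J` symmetric, zero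
diagonal, `d = dim E ≥ 2`). -/
theorem third_moment_esAction_scalar (h2 : 2 ≤ Module.finrank ℝ E) (hJ0 : ∀ n, J n n = 0)
    (hJs : ∀ n m, J n m = J m n) (κ S₀ : ℝ) :
    ∫ ω, (esAction κ S₀ (fun n m => J n m • ContinuousLinearMap.id ℝ E)
        (fun m => ((ω : Λ → sphere (0 : E) 1) m : E)) - S₀) ^ 3
        ∂Measure.pi (fun _ : Λ => uniformSphere (volume : Measure E)) =
      -(8 * κ ^ 3) / (Module.finrank ℝ E : ℝ) ^ 2 * (Matrix.of (fun k n => J k n) ^ 3).trace := by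
  have hd : (Module.finrank ℝ E : ℝ) ≠ 0 := by
    have : (0 : ℝ) < (Module.finrank ℝ E : ℝ) := by exact_mod_cast Module.finrank_pos
    exact this.ne'
  rw [third_moment_esAction_eq h2 (scalar_couplings_diag_zero J hJ0) (scalar_couplings_adjoint J hJs)
    κ S₀, sum_triangle_trace_scalar J hJs]
  field_simp

variable {St : ℕ → (Λ → E) → ℝ} {c : ℕ → ℝ}

/-- **`ċ₂ = (4κ³/d²)·tr(J³)` FOR THE O(N)/HEISENBERG ACTION**: Lüscher's NNLO constant, for every
`C²` Lüscher series of `S = −κ Σ_{n,m} J_nm⟪x_n, x_m⟫ + S₀` with `J` symmetric and zero on the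
diagonal, on an arbitrary finite weighted graph (`tr(J³)` = the weighted count of closed
3-walks). -/
theorem luscher_constant_two_eq_trace_cube (h2 : 2 ≤ Module.finrank ℝ E) (hJ0 : ∀ n, J n n = 0)
    (hJs : ∀ n m, J n m = J m n) (κ S₀ : ℝ) (hSt : ∀ k, ContDiff ℝ 2 (St k))
    (h0 : ∀ ξ : Λ → sphere (0 : E) 1,
      -∑ n, siteLaplacian n (St 0) (fun m => (ξ m : E)) =
        esAction κ S₀ (fun n m => J n m • ContinuousLinearMap.id ℝ E) (fun m => (ξ m : E)) + c 0)
    (hs : ∀ k, ∀ ξ : Λ → sphere (0 : E) 1,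
      -∑ n, siteLaplacian n (St (k + 1)) (fun m => (ξ m : E)) =
        -(∑ n, ⟪siteGrad n (esAction κ S₀ (fun n m => J n m • ContinuousLinearMap.id ℝ E))
            (fun m => (ξ m : E)), siteGrad n (St k) (fun m => (ξ m : E))⟫) + c (k + 1)) :
    c 2 = 4 * κ ^ 3 / (Module.finrank ℝ E : ℝ) ^ 2 * (Matrix.of (fun k n => J k n) ^ 3).trace := by
  have hd : (Module.finrank ℝ E : ℝ) ≠ 0 := by
    have : (0 : ℝ) < (Module.finrank ℝ E : ℝ) := by exact_mod_cast Module.finrank_pos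
    exact this.ne'
  rw [luscher_constant_two_eq_triangles h2 (scalar_couplings_diag_zero J hJ0)
    (scalar_couplings_adjoint J hJs) κ S₀ hSt h0 hs, sum_triangle_trace_scalar J hJs]
  field_simp

end ON

end Summit.Ventures.LatticeQCDFlow.Exactness

end
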